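import Summits.HodgeConjecture.HodgeConjecture.Theses.NikulinTwinTransport

/-!
# `TwinTwistorTransport` (stmt-HodgeConjecture-14393, typed rev-7 form) · Negative · clause hygiene

Negative knowledge / hygiene for the four conclusion clauses of the typed OUTPUT form of the crux
`TwinTwistorTransport` (route NikulinTwinTransport, r4) — (R) `Ψ⁻¹` rational, (T) `Ψ⁻¹`
type-preserving, (H) `u.v = 2b·p ⟹ Ψ⁻¹u.Ψ⁻¹v = b·p″`, (A) `Ψ = [γ]_*`, `γ` algebraic — proved on
linear-algebra shadows of the real carriers (bilinear forms over a field `K` with `2 ≠ 0`; lattices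
with integer forms):

* `selfAnchor_smul_passes_all_but_rationality` — (R) IS LOAD-BEARING: `Ψ = c • id`, `c² = 2`, passes
  (H) identically, (T) on every subspace and (A) modulo `[Δ]_* = id` (the tree's `algebraicClasses` is
  a `ℂ`-subspace, so `√2·[Δ]` is "algebraic"); only `IsRationalClass` stops the junk self-anchor
  `S″ = S` (real-carrier version: `Cruxes/TwinTwistorTransport/Disproof.lean`, `withoutR_of_diagonalClass`).
* `halving_id_forces_zero` — MULTIPLIER RIGIDITY: `Ψ = id` satisfies (H) only if the form is `0`; the
  diagonal / a Fourier–Mukai partner is never a witness, so the route's cheapest falsifier "run it at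
  `ι = id`" tests the mechanism, not this typed statement.
* `halving_iff_twoSimilitude` — (H) on `Ψ⁻¹` is exactly "`Ψ` doubles the form", the hypothesis shape
  of `TwinSimilitudeAlgebraic` consumed by `Theorems.twinSimilitudeAlgebraic_of_anchor`.
* `not_integral_halving` — the strengthening "`Ψ⁻¹` INTEGRAL" is false on a unimodular lattice
  (`e.f = 1` in `U ⊂ Λ_K3`); `Ψ⁻¹` is at best half-integral while `Ψ` can be integral (landed
  `eEightTwoSimilitude_proof`), so the clause rightly asks rationality only.
* `symm_mem_of_map_le_of_finrank_eq`, `symm_mem_of_forall_mem` — (T) and (R) for `Ψ⁻¹` FOLLOW from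
  the same property of `Ψ` and equality of (Hodge / Betti) dimensions: bookkeeping, not content.
* `orientation_rescaling_absorbed`, `sign_of_generator_absorbed` — the outer `∀ μ` (orientation
  families differ by a unit on connected `X(ℂ)`) and the sign of the `∀ p` are absorbed by `γ ↦ c⁻¹γ`
  and `p″ ↦ −p″`.
Refuter seat refuter-cdisprove-stmt-HodgeConjecture-14393-0 (gen 1, typed form), 2026-08-16; work file
`Cruxes/TwinTwistorTransport/Disproof.lean` §T1, T2, T4–T9.
-/

namespace Summit.HodgeConjecture.HodgeConjecture.Theorems.TwinTwistorTransport.Negative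

/-- LOAD-BEARING (R).  Over any field with `c² = 2 ≠ 0`, the self-map `Ψ = c • id` passes every
clause of the crux except rationality: (H) `B u v = 2b ⟹ B (c⁻¹u) (c⁻¹v) = b`; (T) `c⁻¹ •` preserves
every subspace; (A) `c • id ∈ K ∙ id` (and `id = [Δ]_*`, `algebraicClasses` a `ℂ`-subspace).  So the
crux WITHOUT the clause `IsRationalClass (Ψ.symm y)` is closed by `S″ = S`, and any proof of the crux
must use that rational classes are not closed under `√2`. [folklore] -/
theorem selfAnchor_smul_passes_all_but_rationality {K V : Type*} [Field K] [AddCommGroup V] [Module K V]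
    (B : V →ₗ[K] V →ₗ[K] K) {c : K}
    (hc : c * c = 2) (h2 : (2 : K) ≠ 0) :
    (∀ (u v : V) (b : K), B u v = 2 * b → B (c⁻¹ • u) (c⁻¹ • v) = b) ∧
    (∀ (W : Submodule K V), ∀ y ∈ W, c⁻¹ • y ∈ W) ∧
    (c • (LinearMap.id : V →ₗ[K] V) ∈ Submodule.span K {(LinearMap.id : V →ₗ[K] V)}) := by
  have hc0 : c ≠ 0 := by
    rintro rfl
    exact h2 (by simpa using hc.symm)
  refine ⟨fun u v b h => ?_, fun W y hy => W.smul_mem _ hy,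
    Submodule.smul_mem _ _ (Submodule.subset_span rfl)⟩
  rw [LinearMap.map_smul₂, map_smul, smul_eq_mul, smul_eq_mul, h]
  have : c⁻¹ * (c⁻¹ * (2 * b)) = (c * c)⁻¹ * 2 * b := by
    rw [mul_inv]
    ring
  rw [this, hc, inv_mul_cancel₀ h2, one_mul]

/-- MULTIPLIER RIGIDITY.  If a bilinear form satisfies the crux's halving clause for `Ψ = id`,
`B u v = 2b ⟹ B u v = b`, then `B = 0`.  On a K3 surface the cup form is non-zero, so `S″ = S`,
`Ψ = id` (Buskin's identity, a Fourier–Mukai partner) is never a witness: the typed crux cannot be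
"run at `ι = id`"; that cheapest falsifier of the route tests the mechanism, not this statement.
[folklore] -/
theorem halving_id_forces_zero {K V : Type*} [Field K] [AddCommGroup V] [Module K V]
    (B : V →ₗ[K] V →ₗ[K] K) (h2 : (2 : K) ≠ 0)
    (h : ∀ (u v : V) (b : K), B u v = 2 * b → B u v = b) : B = 0 := by
  ext u v
  have hb : B u v = 2 * (B u v / 2) := by
    rw [mul_div_cancel₀ _ h2]
  have h' := h u v (B u v / 2) hb
  -- `x = x / 2` with `2 ≠ 0` forces `x = 0`
  have hx : 2 * (B u v) = B u v := by
    conv_rhs => rw [hb, ← h']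
  have : B u v = 0 := by
    have h3 : (2 - 1) * B u v = 0 := by rw [sub_mul, one_mul, hx, sub_self]
    norm_num at h3
    exact h3
  simpa using this

/-- (H) = 2-SIMILITUDE.  For a linear equivalence `Ψ` and `2 ≠ 0`, the crux's halving clause on `Ψ⁻¹`
(`B u v = 2b ⟹ B″ (Ψ⁻¹u) (Ψ⁻¹v) = b`) is equivalent to `Ψ` doubling the form
(`B (Ψx) (Ψy) = 2·B″ x y`), the hypothesis shape of `TwinSimilitudeAlgebraic` / of
`Theorems.twinSimilitudeAlgebraic_of_anchor`. [folklore] -/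
theorem halving_iff_twoSimilitude {K V V'' : Type*} [Field K] [AddCommGroup V] [Module K V]
    [AddCommGroup V''] [Module K V'']
    (Ψ : V'' ≃ₗ[K] V) (B : V →ₗ[K] V →ₗ[K] K)
    (B'' : V'' →ₗ[K] V'' →ₗ[K] K) (h2 : (2 : K) ≠ 0) :
    (∀ (u v : V) (b : K), B u v = 2 * b → B'' (Ψ.symm u) (Ψ.symm v) = b) ↔
      ∀ x y : V'', B (Ψ x) (Ψ y) = 2 * B'' x y := by
  constructor
  · intro h x y
    have := h (Ψ x) (Ψ y) (B (Ψ x) (Ψ y) / 2) (by rw [mul_div_cancel₀ _ h2])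
    rw [Ψ.symm_apply_apply, Ψ.symm_apply_apply] at this
    rw [this, mul_div_cancel₀ _ h2]
  · intro h u v b hb
    have := h (Ψ.symm u) (Ψ.symm v)
    rw [Ψ.apply_symm_apply, Ψ.apply_symm_apply, hb] at this
    exact (mul_right_injective₀ h2 this).symm

/-- NO INTEGRAL HALVING.  If an additive map `N` between lattices with integer-valued forms
halves the form, `2·B″(Nu, Nv) = B(u, v)`, then `B` takes only even values; on the unimodular K3
lattice `Λ = U³ ⊕ E₈(−1)²` there are `e, f ∈ U` with `e.f = 1`.  So the strengthening of the crux
asking `Ψ⁻¹` to be INTEGRAL (not merely rational) is false; `Ψ⁻¹` is at best half-integral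
(`2Ψ⁻¹ = Ψ^adj` integral when `Ψ` is), while `Ψ` itself can be integral (landed
`Theorems.eEightTwoSimilitude_proof`). [folklore] -/
theorem not_integral_halving {L L'' : Type*} [AddCommGroup L] [AddCommGroup L'']
    (B : L →+ L →+ ℤ) (B'' : L'' →+ L'' →+ ℤ) (N : L →+ L'')
    (h : ∀ u v : L, 2 * B'' (N u) (N v) = B u v) {e f : L} (hef : B e f = 1) : False := by
  have := h e f
  omega

/-- (T) FOR THE INVERSE IS BOOKKEEPING.  If a linear equivalence `Ψ` maps a subspace `W″` into
a finite-dimensional subspace `W` of the same dimension, then `Ψ⁻¹` maps `W` into `W″`.  With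
`W″ = H^{i,j}(S″)`, `W = H^{i,j}(S)` (`h^{i,j} = 1, 20, 1`): an algebraic, hence Hodge, `Ψ` has a
type-preserving inverse — clause (T) of the crux costs a prover nothing beyond (A), bijectivity and
the Hodge numbers of a K3. [folklore] -/
theorem symm_mem_of_map_le_of_finrank_eq {K V V'' : Type*} [Field K] [AddCommGroup V] [Module K V]
    [AddCommGroup V''] [Module K V'']
    (Ψ : V'' ≃ₗ[K] V) (W'' : Submodule K V'')
    (W : Submodule K V) [FiniteDimensional K W] (hmap : W''.map (Ψ : V'' →ₗ[K] V) ≤ W)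
    (hdim : Module.finrank K W'' = Module.finrank K W) {y : V} (hy : y ∈ W) :
    Ψ.symm y ∈ W'' := by
  have heq : W''.map (Ψ : V'' →ₗ[K] V) = W :=
    Submodule.eq_of_le_of_finrank_eq hmap (by rw [LinearEquiv.finrank_map_eq, hdim])
  rw [← heq] at hy
  obtain ⟨x, hx, rfl⟩ := hy
  simpa using hx

/-- (R) FOR THE INVERSE IS BOOKKEEPING, pointwise form of the previous lemma: if `Ψ` maps every element of
`W″` into `W`, `dim W″ = dim W < ∞`, then `Ψ⁻¹` maps `W` into `W″`.  Applied over `K = ℚ` to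
`Ψ.restrictScalars ℚ` and the `ℚ`-forms `H²(S″,ℚ)`, `H²(S,ℚ)` (both of dimension `22`): a rational
bijective `Ψ` has a rational inverse. [folklore] -/
theorem symm_mem_of_forall_mem {K V V'' : Type*} [Field K] [AddCommGroup V] [Module K V]
    [AddCommGroup V''] [Module K V'']
    (Ψ : V'' ≃ₗ[K] V) (W'' : Submodule K V'') (W : Submodule K V)
    [FiniteDimensional K W] (hmap : ∀ x ∈ W'', Ψ x ∈ W)
    (hdim : Module.finrank K W'' = Module.finrank K W) {y : V} (hy : y ∈ W) :
    Ψ.symm y ∈ W'' := by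
  refine symm_mem_of_map_le_of_finrank_eq Ψ W'' W ?_ hdim hy
  rintro _ ⟨x, hx, rfl⟩
  exact hmap x hx

/-- `∀ μ` HARMLESS.  If `Ψ x = G x γ` for a map `G` linear in `γ` (here: `γ ↦ fst_*(snd^*x ∪ γ)`)
with `γ` in a subspace `A` (the algebraic classes, a `ℂ`-subspace), then for every unit `c` (the
ratio of two `ℂ`-orientation families on the connected manifolds `(S × S″)(ℂ)`, `S(ℂ)`, by which the
Gysin map rescales) `Ψ x = (c • G x) γ'` with `γ' = c⁻¹ • γ ∈ A`. [folklore] -/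
theorem orientation_rescaling_absorbed {K V V'' : Type*} [Field K] [AddCommGroup V] [Module K V]
    [AddCommGroup V''] [Module K V'']
    {H : Type*} [AddCommGroup H] [Module K H]
    (G : V'' → (H →ₗ[K] V)) (A : Submodule K H) {γ : H} (hγ : γ ∈ A) {c : K} (hc : c ≠ 0) :
    ∃ γ' ∈ A, ∀ x : V'', G x γ = (c • G x) γ' :=
  ⟨c⁻¹ • γ, A.smul_mem _ hγ, fun x => by simp [hc]⟩

/-- SIGN OF `p` HARMLESS.  The halving clause for the generator pair `(p, p″)` is equivalent to
the clause for `(−p, −p″)`: the `∀ p` over both integral generators `±[S]` is answered by choosing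
`p″` with the matching sign. Shadow: cup values written as multiples of the generators. [folklore] -/
theorem sign_of_generator_absorbed {K V V'' L : Type*} [Field K] [AddCommGroup L] [Module K L]
    (cup : V → V → L) (cup'' : V'' → V'' → L) (N : V → V'') (p p'' : L) :
    (∀ (u v : V) (b : K), cup u v = (2 * b) • p → cup'' (N u) (N v) = b • p'') ↔
      ∀ (u v : V) (b : K), cup u v = (2 * b) • (-p) → cup'' (N u) (N v) = b • (-p'') := by
  constructor
  · intro h u v b hb
    have := h u v (-b) (by rw [hb, smul_neg, ← neg_smul, mul_neg])
    rw [this, neg_smul, smul_neg]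
  · intro h u v b hb
    have := h u v (-b) (by rw [hb, smul_neg, ← neg_smul, mul_neg, neg_neg])
    rw [this, neg_smul, smul_neg, neg_neg]

end Summit.HodgeConjecture.HodgeConjecture.Theorems.TwinTwistorTransport.Negative
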